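/-
Copyright (c) 2026 the pub-hodgecm-mathlib formalisation cell (harness21).  Prover seat hodgecm-mathlib-K2E4-p18 (g3), HCML Track B «K2-LIT» ∕ h413
(stmt-HodgeConjecture-24833); line (ii′), sub-letter (H♮), FILE 4a of the (Ψ-package♮) payer (line lead K2E4-p06 (g2) GO 2026-09-04T00:04:24Z).
-/
import Summits.HodgeConjecture.HodgeConjecture.Theorems.K2E3SingularTransferSignedOfLimitFormulas   -- ★ p855452 (K2E4-p06): the frame-light imports of unit U3b
import Literature.MeasureTheory.Group.OrbitalMeasureOfProdCommFactor                               -- ★ `exists_integral_descConj_eq_smul_of_comm` (orbital integrals on `G₁ × A`, `A` commutative)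
import Literature.MeasureTheory.Group.InvariantQuotientOrbitalTransport                             -- ★ `exists_integral_descConj_eq_smul_integral_descConj_of_conj_eq`, `cosetCongr{,Homeomorph}`
import Literature.NumberTheory.Rogawski1990.UnitaryTwoOneCentralUnipotentStrataCM                   -- ★ (K2E3-p23) `cmDatum_local_one_mul_comm`, `fst_comm_of_mem_center`, `centralUnipotent_conj_iff`
import Literature.NumberTheory.Automorphic.UnitOrbitalIntegralFixedPointsPair                       -- ★ `compactSpace_cmDatum_local_one_of_smul_eq` (`U(Φ₁)_v` compact at a non-split `v`)
import Literature.NumberTheory.Rogawski1990.ExplicitFactorKappaAlmostEverywhereOne                  -- ★ `smul_placesOver_eq_of_subsingleton`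
import Mathlib.Topology.Algebra.ProperAction.Basic                                                -- `QuotientGroup.instT2Space` (coset space of a closed subgroup)
import HarnessLib

/-!
# K2 · E3 — `Theorems/K2E3CentralUnipotentScalingOfFactor.lean`: THE SCALING LAW FOR UNIPOTENT ORBITAL INTEGRALS PASSES FROM `U(Φ₂)_v` TO
# `H_v = U(Φ₂)_v × U(Φ₁)_v` (classes over a central `z`; Gelbart 1975 (10.19), Rogawski 1990 §4.9: `H = U(2) × U(1)` with `U(1)` abelian)

HCML Track B «K2-LIT», cell `pub/hodgecm-mathlib`, crux H413 = `stmt-HodgeConjecture-24833` (lane `--supports … --as helper`); seat `hodgecm-mathlib-K2E4-p18` (g3).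
FILE 4a of the payer of (Ψ-package♮) `sig_K2E3CentralUnipotentScalingPackage` (cand 3b2da8799baa6d2f; consumed by ★ p855910): its clause (SC) asks, ON `H_v` and for EVERY
orbital-measure family admissible on the classes over `z`, `Φ_{mU}(u, 1_{U₀^H}·(F∘Ψ_H)) = q^{a u}·Φ_{mU}(u, F)` for the product map `Ψ_H(γ) = (Ψ γ.1, γ.2)` and
`U₀^H = U₀ × U(Φ₁)_v`; the rank-one Cayley road (★ K2E5-p12 `K2E3CayleyScalingRankOne{,Map,Package}`) delivers the law ON `U(Φ₂)_v`.  THIS FILE is the transport: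
**(SC) on `U(Φ₂)_v` at the classes over `ζ = z.1` for every admissible `U(Φ₂)_v`-family ⇒ (SC) on `H_v` at the classes over `z` for every admissible `H_v`-family**,
for ANY pair `(Ψ, U₀)` (no Cayley internals).

THE MATHEMATICS.  Let `u` be a class of `H_v` over `z` with representative `x = (x₁, x₂)` (`x₂ = z.2`, `U(Φ₁)` commutative) and `μ = mU u` on `H_v ⧸ Z(x)`.  (1) A non-zero
invariant Radon measure `μ₁` on `U₂ ⧸ Z(x₁)` exists: the push-forward of `μ` along `H_v ⧸ Z(x) = (U₂ × U₁) ⧸ (Z(x₁) × Z(x₂)) ≅ (U₂ ⧸ Z(x₁)) × (U₁ ⧸ Z(x₂)) → U₂ ⧸ Z(x₁)`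
(★ `cosetCongr`, ★ `quotientProdHomeomorph`; finite on compacts because `U₁` is compact at a non-split `v`).  (2) ★ `exists_integral_descConj_eq_smul_of_comm` (Gelbart
(10.19) for ANY invariant measure): ONE `c ≠ 0` with `∫_{H⧸Z(x)} Φ(y x y⁻¹) dμ = c·∫_{U₂⧸Z(x₁)} Φ(g x₁ g⁻¹, x₂) dμ₁` for every `Φ`.  (3) Transport `μ₁` along `y x₁ y⁻¹ =
out⟦x₁⟧` (★ `cosetCongrHomeomorph (conj y)`) to an admissible one-class family `mU₂` on `U₂`; ★ `exists_integral_descConj_eq_smul_integral_descConj_of_conj_eq` gives ONE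
`c′ ≠ 0` with `Φ_{mU₂}(⟦x₁⟧, K) = c′·∫_{U₂⧸Z(x₁)} K(g x₁ g⁻¹) dμ₁` for every `K`.  (4) The class `⟦x₁⟧` lies over `ζ` (the `H`-literal for `(y,1)·x·(y,1)⁻¹`, ★
`centralUnipotent_conj_iff`), the section `K = F(·, x₂)` is in `C_c^∞(U₂)`, and `(1_{U₀^H}·(F∘Ψ_H))(g, x₂) = (1_{U₀}·(K∘Ψ))(g)`; so the `U₂`-law at `⟦x₁⟧` multiplied by
`c∕c′` is the `H_v`-law at `u`, with exponent `a_H(u) := a(⟦(out u).1⟧)`.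

* §1 `indicator_prod_univ_comp_apply`, `isLocSmooth_section` — sections of `C_c^∞(H_v)` functions.
* §2 `exists_smulInvariantMeasure_quotient_fst` — a non-zero invariant Radon measure on `U₂ ⧸ Z(x₁)` from one on `H_v ⧸ Z(x)`.
* §3 **`classOrbitalIntegral_indicator_comp_prod_eq_mul`** — THE TRANSPORT (hypothesis: the `U₂`-law at the classes over `z.1`, all admissible `U₂`-families;
  conclusion: the `H_v`-law at the classes over `z`, all admissible `H_v`-families).

HONEST LABEL: HC_CM is proved only modulo the 7 printed citations (2 remaining named inputs: hLiu418 = stmt-HodgeConjecture-24832, h413 = stmt-HodgeConjecture-24833) until rung 0 closes.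
Count-neutral helper (FILE 4b assembles (Ψ-package♮) from the rank-one package and this transport).  No `sorry`, axioms ⊆ {propext, Classical.choice, Quot.sound},
no `def`, no instance, no notation.

## References
* [Gelbart1975] S. Gelbart, *Automorphic Forms on Adele Groups*, Ann. of Math. Stud. 83 (1975), p. 155 (10.19).
* [Rogawski1990] J. D. Rogawski, *Automorphic Representations of Unitary Groups in Three Variables*, Ann. of Math. Stud. 123 (1990): §4.9 p. 54 (`H = U(2) × U(1)`); §8.1
  Prop. 8.1.2 (b) p. 114 (homogeneity of the unipotent orbital integrals).
* [Folland1995] G. B. Folland, *A Course in Abstract Harmonic Analysis* (1995), Thm. 2.49.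
-/

set_option autoImplicit false
set_option linter.dupNamespace false

noncomputable section

open Filter Topology
open MeasureTheory Measure NumberField IsDedekindDomain
open Literature.MeasureTheory.Group Literature.MeasureTheory.RestrictedProduct
open Literature.Topology.RestrictedProduct Literature.Topology.Algebra.RestrictedProduct
open Literature.NumberTheory.Rogawski1990 Literature.NumberTheory.Automorphic Literature.NumberTheory.Automorphic.UnitaryGroup
open Literature.AlgebraicGeometry.ShimuraVarieties (unitaryGroup hermForm)
open scoped Matrix MatrixGroups RestrictedProduct NNReal

namespace Summit.HodgeConjecture.HodgeConjecture.Cruxes.H413.K2E3CentralUnipotentScalingOfFactor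

variable (L : Type) [Field L] [NumberField L] [IsCMField L] (v : HeightOneSpectrum (𝓞 ↥(maximalRealSubfield L)))

/-! ## §1 Sections of smooth functions on `H_v = U₂ × U₁` -/

/-- The product pull-back `1_{U₀ × U₁}·(F ∘ (Ψ × id))` read on the slice `{·} × {k}` is the pull-back `1_{U₀}·(F(·, k) ∘ Ψ)`. [cite: Gelbart1975, p. 155 (10.19)] -/
theorem indicator_prod_univ_comp_apply (U₀ : Set ((UnitaryGroup.cmDatum L 2 (Matrix.of fun i j : Fin 2 => if i.val + j.val + 1 = 2 then (1 : L) else 0)).Local v)) (Ψ : (UnitaryGroup.cmDatum L 2 (Matrix.of fun i j : Fin 2 => if i.val + j.val + 1 = 2 then (1 : L) else 0)).Local v → (UnitaryGroup.cmDatum L 2 (Matrix.of fun i j : Fin 2 => if i.val + j.val + 1 = 2 then (1 : L) else 0)).Local v)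
    (F : (UnitaryGroup.cmDatum L 2 (Matrix.of fun i j : Fin 2 => if i.val + j.val + 1 = 2 then (1 : L) else 0)).Local v × (UnitaryGroup.cmDatum L 1 (Matrix.of fun i j : Fin 1 => if i.val + j.val + 1 = 1 then (1 : L) else 0)).Local v → ℂ) (g : (UnitaryGroup.cmDatum L 2 (Matrix.of fun i j : Fin 2 => if i.val + j.val + 1 = 2 then (1 : L) else 0)).Local v) (k : (UnitaryGroup.cmDatum L 1 (Matrix.of fun i j : Fin 1 => if i.val + j.val + 1 = 1 then (1 : L) else 0)).Local v) :
    (U₀ ×ˢ (Set.univ : Set ((UnitaryGroup.cmDatum L 1 (Matrix.of fun i j : Fin 1 => if i.val + j.val + 1 = 1 then (1 : L) else 0)).Local v))).indicator (F ∘ fun γ : (UnitaryGroup.cmDatum L 2 (Matrix.of fun i j : Fin 2 => if i.val + j.val + 1 = 2 then (1 : L) else 0)).Local v × (UnitaryGroup.cmDatum L 1 (Matrix.of fun i j : Fin 1 => if i.val + j.val + 1 = 1 then (1 : L) else 0)).Local v => (Ψ γ.1, γ.2)) (g, k) =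
      U₀.indicator ((fun g' : (UnitaryGroup.cmDatum L 2 (Matrix.of fun i j : Fin 2 => if i.val + j.val + 1 = 2 then (1 : L) else 0)).Local v => F (g', k)) ∘ Ψ) g := by
  by_cases hg : g ∈ U₀
  · rw [Set.indicator_of_mem (Set.mk_mem_prod hg (Set.mem_univ k)), Set.indicator_of_mem hg]
    rfl
  · rw [Set.indicator_of_notMem (fun h => hg (Set.mem_prod.1 h).1), Set.indicator_of_notMem hg]

/-- A section `g ↦ F(g, k)` of a `C_c^∞` function on `H_v` is `C_c^∞` on `U₂` (locally constant by composition with the continuous slice map; support inside the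
compact projection of the support of `F`). [cite: Rogawski1990, §1.6 p. 6] -/
theorem isLocSmooth_section {F : (UnitaryGroup.cmDatum L 2 (Matrix.of fun i j : Fin 2 => if i.val + j.val + 1 = 2 then (1 : L) else 0)).Local v × (UnitaryGroup.cmDatum L 1 (Matrix.of fun i j : Fin 1 => if i.val + j.val + 1 = 1 then (1 : L) else 0)).Local v → ℂ} (hF : IsLocSmooth F) (k : (UnitaryGroup.cmDatum L 1 (Matrix.of fun i j : Fin 1 => if i.val + j.val + 1 = 1 then (1 : L) else 0)).Local v) :
    IsLocSmooth (fun g : (UnitaryGroup.cmDatum L 2 (Matrix.of fun i j : Fin 2 => if i.val + j.val + 1 = 2 then (1 : L) else 0)).Local v => F (g, k)) := by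
  refine ⟨hF.isLocallyConstant.comp_continuous (continuous_id.prodMk continuous_const), ?_⟩
  refine HasCompactSupport.intro ((hF.hasCompactSupport.isCompact).image continuous_fst) fun g hg => ?_
  by_contra h
  exact hg ⟨(g, k), subset_tsupport _ (Function.mem_support.2 h), rfl⟩

/-! ## §2 A non-zero invariant Radon measure on `U₂ ⧸ Z(x₁)` from one on `H_v ⧸ Z(x)` -/

/-- **PUSH-FORWARD TO THE FIRST FACTOR.**  For `x = (x₁, x₂) ∈ H_v` and a non-zero `H_v`-invariant measure `μ` on `H_v ⧸ Z(x)` finite on compacts, the push-forward along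
`H_v ⧸ Z(x) = (U₂ × U₁) ⧸ (Z(x₁) × Z(x₂)) ≅ (U₂ ⧸ Z(x₁)) × (U₁ ⧸ Z(x₂)) → U₂ ⧸ Z(x₁)` (★ `cosetCongr`, ★ `quotientProdHomeomorph`, `Prod.fst`) is a non-zero
`U₂`-invariant measure finite on compacts (`U₁`, hence `U₁ ⧸ Z(x₂)`, is compact at a non-split `v`). [cite: Gelbart1975, p. 155 (10.19)] [cite: Folland1995, Thm. 2.49] -/
theorem exists_smulInvariantMeasure_quotient_fst (hns : Subsingleton (UnitaryGroup.PlacesOver L v))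
    [∀ a : (UnitaryGroup.cmDatum L 2 (Matrix.of fun i j : Fin 2 => if i.val + j.val + 1 = 2 then (1 : L) else 0)).Local v × (UnitaryGroup.cmDatum L 1 (Matrix.of fun i j : Fin 1 => if i.val + j.val + 1 = 1 then (1 : L) else 0)).Local v, MeasurableSpace (((UnitaryGroup.cmDatum L 2 (Matrix.of fun i j : Fin 2 => if i.val + j.val + 1 = 2 then (1 : L) else 0)).Local v × (UnitaryGroup.cmDatum L 1 (Matrix.of fun i j : Fin 1 => if i.val + j.val + 1 = 1 then (1 : L) else 0)).Local v) ⧸ Subgroup.centralizer ({a} : Set ((UnitaryGroup.cmDatum L 2 (Matrix.of fun i j : Fin 2 => if i.val + j.val + 1 = 2 then (1 : L) else 0)).Local v × (UnitaryGroup.cmDatum L 1 (Matrix.of fun i j : Fin 1 => if i.val + j.val + 1 = 1 then (1 : L) else 0)).Local v)))]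
    [∀ a : (UnitaryGroup.cmDatum L 2 (Matrix.of fun i j : Fin 2 => if i.val + j.val + 1 = 2 then (1 : L) else 0)).Local v × (UnitaryGroup.cmDatum L 1 (Matrix.of fun i j : Fin 1 => if i.val + j.val + 1 = 1 then (1 : L) else 0)).Local v, BorelSpace (((UnitaryGroup.cmDatum L 2 (Matrix.of fun i j : Fin 2 => if i.val + j.val + 1 = 2 then (1 : L) else 0)).Local v × (UnitaryGroup.cmDatum L 1 (Matrix.of fun i j : Fin 1 => if i.val + j.val + 1 = 1 then (1 : L) else 0)).Local v) ⧸ Subgroup.centralizer ({a} : Set ((UnitaryGroup.cmDatum L 2 (Matrix.of fun i j : Fin 2 => if i.val + j.val + 1 = 2 then (1 : L) else 0)).Local v × (UnitaryGroup.cmDatum L 1 (Matrix.of fun i j : Fin 1 => if i.val + j.val + 1 = 1 then (1 : L) else 0)).Local v)))]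
    [∀ γ : (UnitaryGroup.cmDatum L 2 (Matrix.of fun i j : Fin 2 => if i.val + j.val + 1 = 2 then (1 : L) else 0)).Local v, MeasurableSpace ((UnitaryGroup.cmDatum L 2 (Matrix.of fun i j : Fin 2 => if i.val + j.val + 1 = 2 then (1 : L) else 0)).Local v ⧸ Subgroup.centralizer ({γ} : Set ((UnitaryGroup.cmDatum L 2 (Matrix.of fun i j : Fin 2 => if i.val + j.val + 1 = 2 then (1 : L) else 0)).Local v)))]
    [∀ γ : (UnitaryGroup.cmDatum L 2 (Matrix.of fun i j : Fin 2 => if i.val + j.val + 1 = 2 then (1 : L) else 0)).Local v, BorelSpace ((UnitaryGroup.cmDatum L 2 (Matrix.of fun i j : Fin 2 => if i.val + j.val + 1 = 2 then (1 : L) else 0)).Local v ⧸ Subgroup.centralizer ({γ} : Set ((UnitaryGroup.cmDatum L 2 (Matrix.of fun i j : Fin 2 => if i.val + j.val + 1 = 2 then (1 : L) else 0)).Local v)))]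
    (x : (UnitaryGroup.cmDatum L 2 (Matrix.of fun i j : Fin 2 => if i.val + j.val + 1 = 2 then (1 : L) else 0)).Local v × (UnitaryGroup.cmDatum L 1 (Matrix.of fun i j : Fin 1 => if i.val + j.val + 1 = 1 then (1 : L) else 0)).Local v) (μ : Measure (((UnitaryGroup.cmDatum L 2 (Matrix.of fun i j : Fin 2 => if i.val + j.val + 1 = 2 then (1 : L) else 0)).Local v × (UnitaryGroup.cmDatum L 1 (Matrix.of fun i j : Fin 1 => if i.val + j.val + 1 = 1 then (1 : L) else 0)).Local v) ⧸ Subgroup.centralizer ({x} : Set ((UnitaryGroup.cmDatum L 2 (Matrix.of fun i j : Fin 2 => if i.val + j.val + 1 = 2 then (1 : L) else 0)).Local v × (UnitaryGroup.cmDatum L 1 (Matrix.of fun i j : Fin 1 => if i.val + j.val + 1 = 1 then (1 : L) else 0)).Local v))))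
    [SMulInvariantMeasure ((UnitaryGroup.cmDatum L 2 (Matrix.of fun i j : Fin 2 => if i.val + j.val + 1 = 2 then (1 : L) else 0)).Local v × (UnitaryGroup.cmDatum L 1 (Matrix.of fun i j : Fin 1 => if i.val + j.val + 1 = 1 then (1 : L) else 0)).Local v) (((UnitaryGroup.cmDatum L 2 (Matrix.of fun i j : Fin 2 => if i.val + j.val + 1 = 2 then (1 : L) else 0)).Local v × (UnitaryGroup.cmDatum L 1 (Matrix.of fun i j : Fin 1 => if i.val + j.val + 1 = 1 then (1 : L) else 0)).Local v) ⧸ Subgroup.centralizer ({x} : Set ((UnitaryGroup.cmDatum L 2 (Matrix.of fun i j : Fin 2 => if i.val + j.val + 1 = 2 then (1 : L) else 0)).Local v × (UnitaryGroup.cmDatum L 1 (Matrix.of fun i j : Fin 1 => if i.val + j.val + 1 = 1 then (1 : L) else 0)).Local v))) μ] [IsFiniteMeasureOnCompacts μ] (hμ : μ ≠ 0) :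
    ∃ μ₁ : Measure ((UnitaryGroup.cmDatum L 2 (Matrix.of fun i j : Fin 2 => if i.val + j.val + 1 = 2 then (1 : L) else 0)).Local v ⧸ Subgroup.centralizer ({x.1} : Set ((UnitaryGroup.cmDatum L 2 (Matrix.of fun i j : Fin 2 => if i.val + j.val + 1 = 2 then (1 : L) else 0)).Local v))),
      SMulInvariantMeasure ((UnitaryGroup.cmDatum L 2 (Matrix.of fun i j : Fin 2 => if i.val + j.val + 1 = 2 then (1 : L) else 0)).Local v) ((UnitaryGroup.cmDatum L 2 (Matrix.of fun i j : Fin 2 => if i.val + j.val + 1 = 2 then (1 : L) else 0)).Local v ⧸ Subgroup.centralizer ({x.1} : Set ((UnitaryGroup.cmDatum L 2 (Matrix.of fun i j : Fin 2 => if i.val + j.val + 1 = 2 then (1 : L) else 0)).Local v))) μ₁ ∧ IsFiniteMeasureOnCompacts μ₁ ∧ SFinite μ₁ ∧ μ₁ ≠ 0 := by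
  obtain ⟨w⟩ := UnitaryGroup.PlacesOver.nonempty L v
  haveI : CompactSpace ((UnitaryGroup.cmDatum L 1 (Matrix.of fun i j : Fin 1 => if i.val + j.val + 1 = 1 then (1 : L) else 0)).Local v) :=
    compactSpace_cmDatum_local_one_of_smul_eq L (Matrix.of fun i j : Fin 1 => if i.val + j.val + 1 = 1 then (1 : L) else 0) w (smul_placesOver_eq_of_subsingleton L v (IsCMField.complexConj L) hns w)
      (isUnit_placeForm_antidiagOne (E := L) 1 w.1)
  -- the intermediate coset spaces carry their Borel σ-algebras
  letI : MeasurableSpace (((UnitaryGroup.cmDatum L 2 (Matrix.of fun i j : Fin 2 => if i.val + j.val + 1 = 2 then (1 : L) else 0)).Local v × (UnitaryGroup.cmDatum L 1 (Matrix.of fun i j : Fin 1 => if i.val + j.val + 1 = 1 then (1 : L) else 0)).Local v) ⧸ (Subgroup.centralizer ({x.1} : Set ((UnitaryGroup.cmDatum L 2 (Matrix.of fun i j : Fin 2 => if i.val + j.val + 1 = 2 then (1 : L) else 0)).Local v))).prod (Subgroup.centralizer ({x.2} : Set ((UnitaryGroup.cmDatum L 1 (Matrix.of fun i j : Fin 1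 => if i.val + j.val + 1 = 1 then (1 : L) else 0)).Local v)))) := borel _
  haveI : BorelSpace (((UnitaryGroup.cmDatum L 2 (Matrix.of fun i j : Fin 2 => if i.val + j.val + 1 = 2 then (1 : L) else 0)).Local v × (UnitaryGroup.cmDatum L 1 (Matrix.of fun i j : Fin 1 => if i.val + j.val + 1 = 1 then (1 : L) else 0)).Local v) ⧸ (Subgroup.centralizer ({x.1} : Set ((UnitaryGroup.cmDatum L 2 (Matrix.of fun i j : Fin 2 => if i.val + j.val + 1 = 2 then (1 : L) else 0)).Local v))).prod (Subgroup.centralizer ({x.2} : Set ((UnitaryGroup.cmDatum L 1 (Matrix.of fun i j : Fin 1 => if i.val + j.val + 1 = 1 then (1 : L) else 0)).Local v)))) := ⟨rfl⟩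
  letI : MeasurableSpace ((UnitaryGroup.cmDatum L 1 (Matrix.of fun i j : Fin 1 => if i.val + j.val + 1 = 1 then (1 : L) else 0)).Local v ⧸ Subgroup.centralizer ({x.2} : Set ((UnitaryGroup.cmDatum L 1 (Matrix.of fun i j : Fin 1 => if i.val + j.val + 1 = 1 then (1 : L) else 0)).Local v))) := borel _
  haveI : BorelSpace ((UnitaryGroup.cmDatum L 1 (Matrix.of fun i j : Fin 1 => if i.val + j.val + 1 = 1 then (1 : L) else 0)).Local v ⧸ Subgroup.centralizer ({x.2} : Set ((UnitaryGroup.cmDatum L 1 (Matrix.of fun i j : Fin 1 => if i.val + j.val + 1 = 1 then (1 : L) else 0)).Local v))) := ⟨rfl⟩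
  haveI : IsClosed ((Subgroup.centralizer ({x.1} : Set ((UnitaryGroup.cmDatum L 2 (Matrix.of fun i j : Fin 2 => if i.val + j.val + 1 = 2 then (1 : L) else 0)).Local v)) : Subgroup ((UnitaryGroup.cmDatum L 2 (Matrix.of fun i j : Fin 2 => if i.val + j.val + 1 = 2 then (1 : L) else 0)).Local v)) : Set ((UnitaryGroup.cmDatum L 2 (Matrix.of fun i j : Fin 2 => if i.val + j.val + 1 = 2 then (1 : L) else 0)).Local v)) := isClosed_coe_centralizer_singleton x.1
  haveI : IsClosed ((Subgroup.centralizer ({x.2} : Set ((UnitaryGroup.cmDatum L 1 (Matrix.of fun i j : Fin 1 => if i.val + j.val + 1 = 1 then (1 : L) else 0)).Local v)) : Subgroup ((UnitaryGroup.cmDatum L 1 (Matrix.of fun i j : Fin 1 => if i.val + j.val + 1 = 1 then (1 : L) else 0)).Local v)) : Set ((UnitaryGroup.cmDatum L 1 (Matrix.of fun i j : Fin 1 => if i.val + j.val + 1 = 1 then (1 : L) else 0)).Local v)) := isClosed_coe_centralizer_singleton x.2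
  haveI : IsClosed ((Subgroup.centralizer ({x} : Set ((UnitaryGroup.cmDatum L 2 (Matrix.of fun i j : Fin 2 => if i.val + j.val + 1 = 2 then (1 : L) else 0)).Local v × (UnitaryGroup.cmDatum L 1 (Matrix.of fun i j : Fin 1 => if i.val + j.val + 1 = 1 then (1 : L) else 0)).Local v)) : Subgroup ((UnitaryGroup.cmDatum L 2 (Matrix.of fun i j : Fin 2 => if i.val + j.val + 1 = 2 then (1 : L) else 0)).Local v × (UnitaryGroup.cmDatum L 1 (Matrix.of fun i j : Fin 1 => if i.val + j.val + 1 = 1 then (1 : L) else 0)).Local v)) : Set ((UnitaryGroup.cmDatum L 2 (Matrix.of fun i j : Fin 2 => if i.val + j.val + 1 = 2 then (1 : L) else 0)).Local v × (UnitaryGroup.cmDatum L 1 (Matrix.of fun i j : Fin 1 => if i.val + j.val + 1 = 1 then (1 : L) else 0)).Local v)) := isClosed_coe_centralizer_singleton x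
  have hx : (MulEquiv.refl ((UnitaryGroup.cmDatum L 2 (Matrix.of fun i j : Fin 2 => if i.val + j.val + 1 = 2 then (1 : L) else 0)).Local v × (UnitaryGroup.cmDatum L 1 (Matrix.of fun i j : Fin 1 => if i.val + j.val + 1 = 1 then (1 : L) else 0)).Local v)) (x.1, x.2) = x := rfl
  have hHH' : ∀ g : (UnitaryGroup.cmDatum L 2 (Matrix.of fun i j : Fin 2 => if i.val + j.val + 1 = 2 then (1 : L) else 0)).Local v × (UnitaryGroup.cmDatum L 1 (Matrix.of fun i j : Fin 1 => if i.val + j.val + 1 = 1 then (1 : L) else 0)).Local v, (MulEquiv.refl ((UnitaryGroup.cmDatum L 2 (Matrix.of fun i j : Fin 2 => if i.val + j.val + 1 = 2 then (1 : L) else 0)).Local v × (UnitaryGroup.cmDatum L 1 (Matrix.of fun i j : Fin 1 => if i.val + j.val + 1 = 1 then (1 : L) else 0)).Local v)) g ∈ (Subgroup.centralizer ({x.1} : Set ((UnitaryGroup.cmDatum L 2 (Matrix.of fun i j : Fin 2 => if i.val + j.val + 1 = 2 then (1 : L) else 0)).Local v))).prod (Subgroup.centralizer ({x.2} : Set ((UnitaryGroup.cmDatum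 L 1 (Matrix.of fun i j : Fin 1 => if i.val + j.val + 1 = 1 then (1 : L) else 0)).Local v))) ↔
      g ∈ Subgroup.centralizer ({x} : Set ((UnitaryGroup.cmDatum L 2 (Matrix.of fun i j : Fin 2 => if i.val + j.val + 1 = 2 then (1 : L) else 0)).Local v × (UnitaryGroup.cmDatum L 1 (Matrix.of fun i j : Fin 1 => if i.val + j.val + 1 = 1 then (1 : L) else 0)).Local v)) := fun g =>
    (forall_apply_mem_centralizer_iff (MulEquiv.refl ((UnitaryGroup.cmDatum L 2 (Matrix.of fun i j : Fin 2 => if i.val + j.val + 1 = 2 then (1 : L) else 0)).Local v × (UnitaryGroup.cmDatum L 1 (Matrix.of fun i j : Fin 1 => if i.val + j.val + 1 = 1 then (1 : L) else 0)).Local v)) hx g).symm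
  set κ := cosetCongr (MulEquiv.refl ((UnitaryGroup.cmDatum L 2 (Matrix.of fun i j : Fin 2 => if i.val + j.val + 1 = 2 then (1 : L) else 0)).Local v × (UnitaryGroup.cmDatum L 1 (Matrix.of fun i j : Fin 1 => if i.val + j.val + 1 = 1 then (1 : L) else 0)).Local v)) (Subgroup.centralizer ({x} : Set ((UnitaryGroup.cmDatum L 2 (Matrix.of fun i j : Fin 2 => if i.val + j.val + 1 = 2 then (1 : L) else 0)).Local v × (UnitaryGroup.cmDatum L 1 (Matrix.of fun i j : Fin 1 => if i.val + j.val + 1 = 1 then (1 : L) else 0)).Local v))) ((Subgroup.centralizer ({x.1} : Set ((UnitaryGroup.cmDatum L 2 (Matrix.of fun i j : Fin 2 => if i.val + j.val + 1 = 2 then (1 : L) else 0)).Local v))).prod (Subgroup.centralizer ({x.2} : Set ((UnitaryGroup.cmDatum L 1 (Matrix.of fun i j : Fin 1 => if i.val + j.val + 1 = 1 then (1 : L) else 0)).Local v)))) hHH' with hκ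
  set θ := quotientProdHomeomorph (Subgroup.centralizer ({x.1} : Set ((UnitaryGroup.cmDatum L 2 (Matrix.of fun i j : Fin 2 => if i.val + j.val + 1 = 2 then (1 : L) else 0)).Local v))) (Subgroup.centralizer ({x.2} : Set ((UnitaryGroup.cmDatum L 1 (Matrix.of fun i j : Fin 1 => if i.val + j.val + 1 = 1 then (1 : L) else 0)).Local v))) with hθ
  set π : ((UnitaryGroup.cmDatum L 2 (Matrix.of fun i j : Fin 2 => if i.val + j.val + 1 = 2 then (1 : L) else 0)).Local v × (UnitaryGroup.cmDatum L 1 (Matrix.of fun i j : Fin 1 => if i.val + j.val + 1 = 1 then (1 : L) else 0)).Local v) ⧸ Subgroup.centralizer ({x} : Set ((UnitaryGroup.cmDatum L 2 (Matrix.of fun i j : Fin 2 => if i.val + j.val + 1 = 2 then (1 : L) else 0)).Local v × (UnitaryGroup.cmDatum L 1 (Matrix.of fun i j : Fin 1 => if i.val + j.val + 1 = 1 then (1 : L) else 0)).Local v)) → (UnitaryGroup.cmDatum L 2 (Matrix.of fun i j : Fin 2 => if i.val + j.val + 1 = 2 then (1 : L) else 0)).Local v ⧸ Subgroup.centralizer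 ({x.1} : Set ((UnitaryGroup.cmDatum L 2 (Matrix.of fun i j : Fin 2 => if i.val + j.val + 1 = 2 then (1 : L) else 0)).Local v)) := fun y => (θ (κ y)).1 with hπ
  have hκc : Continuous κ := continuous_cosetCongr _ _ _ hHH' continuous_id
  have hπc : Continuous π := continuous_fst.comp (θ.continuous.comp hκc)
  have hπm : Measurable π := hπc.measurable
  -- equivariance under `U₂ × 1`
  have key : ∀ (g : (UnitaryGroup.cmDatum L 2 (Matrix.of fun i j : Fin 2 => if i.val + j.val + 1 = 2 then (1 : L) else 0)).Local v) (y : ((UnitaryGroup.cmDatum L 2 (Matrix.of fun i j : Fin 2 => if i.val + j.val + 1 = 2 then (1 : L) else 0)).Local v × (UnitaryGroup.cmDatum L 1 (Matrix.of fun i j : Fin 1 => if i.val + j.val + 1 = 1 then (1 : L) else 0)).Local v) ⧸ Subgroup.centralizer ({x} : Set ((UnitaryGroup.cmDatum L 2 (Matrix.of fun i j : Fin 2 => if i.val + j.val + 1 = 2 then (1 : L) else 0)).Local v × (UnitaryGroup.cmDatum L 1 (Matrix.of fun i j : Fin 1 => if i.val + j.val + 1 = 1 then (1 : L) else 0)).Local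 v))),
      π (((g, (1 : (UnitaryGroup.cmDatum L 1 (Matrix.of fun i j : Fin 1 => if i.val + j.val + 1 = 1 then (1 : L) else 0)).Local v)) : (UnitaryGroup.cmDatum L 2 (Matrix.of fun i j : Fin 2 => if i.val + j.val + 1 = 2 then (1 : L) else 0)).Local v × (UnitaryGroup.cmDatum L 1 (Matrix.of fun i j : Fin 1 => if i.val + j.val + 1 = 1 then (1 : L) else 0)).Local v) • y) = g • π y := by
    intro g y
    induction y using QuotientGroup.induction_on with
    | H h =>
      simp only [hπ, hκ, hθ, MulAction.Quotient.smul_mk, smul_eq_mul, cosetCongr_mk, MulEquiv.refl_apply, coe_quotientProdHomeomorph, prodEquiv_mk,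
        Prod.fst_mul]
  refine ⟨Measure.map π μ, ⟨fun g S hS => ?_⟩, ⟨fun K hK => ?_⟩, inferInstance, ?_⟩
  · -- invariance
    rw [Measure.map_apply hπm hS, Measure.map_apply hπm (measurable_const_smul g hS)]
    have hset : π ⁻¹' ((fun y => g • y) ⁻¹' S) = (fun y => ((g, (1 : (UnitaryGroup.cmDatum L 1 (Matrix.of fun i j : Fin 1 => if i.val + j.val + 1 = 1 then (1 : L) else 0)).Local v)) : (UnitaryGroup.cmDatum L 2 (Matrix.of fun i j : Fin 2 => if i.val + j.val + 1 = 2 then (1 : L) else 0)).Local v × (UnitaryGroup.cmDatum L 1 (Matrix.of fun i j : Fin 1 => if i.val + j.val + 1 = 1 then (1 : L) else 0)).Local v) • y) ⁻¹' (π ⁻¹' S) := by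
      ext y
      simp only [Set.mem_preimage, key]
    rw [hset]
    exact SMulInvariantMeasure.measure_preimage_smul _ (hS.preimage hπm)
  · -- finite on compacts: the preimage of a compact set is compact (`U₁ ⧸ Z(x₂)` is compact)
    rw [Measure.map_apply hπm hK.measurableSet]
    have hpre : π ⁻¹' K = κ ⁻¹' (θ ⁻¹' (K ×ˢ (Set.univ : Set ((UnitaryGroup.cmDatum L 1 (Matrix.of fun i j : Fin 1 => if i.val + j.val + 1 = 1 then (1 : L) else 0)).Local v ⧸ Subgroup.centralizer ({x.2} : Set ((UnitaryGroup.cmDatum L 1 (Matrix.of fun i j : Fin 1 => if i.val + j.val + 1 = 1 then (1 : L) else 0)).Local v)))))) := by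
      ext y
      simp only [hπ, Set.mem_preimage, Set.mem_prod, Set.mem_univ, and_true]
    have hKc : IsCompact (π ⁻¹' K) := by
      rw [hpre]
      have h1 : IsCompact (θ ⁻¹' (K ×ˢ (Set.univ : Set ((UnitaryGroup.cmDatum L 1 (Matrix.of fun i j : Fin 1 => if i.val + j.val + 1 = 1 then (1 : L) else 0)).Local v ⧸ Subgroup.centralizer ({x.2} : Set ((UnitaryGroup.cmDatum L 1 (Matrix.of fun i j : Fin 1 => if i.val + j.val + 1 = 1 then (1 : L) else 0)).Local v)))))) :=
        (θ.isCompact_preimage).2 (hK.prod isCompact_univ)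
      have hκh : κ = cosetCongrHomeomorph (MulEquiv.refl ((UnitaryGroup.cmDatum L 2 (Matrix.of fun i j : Fin 2 => if i.val + j.val + 1 = 2 then (1 : L) else 0)).Local v × (UnitaryGroup.cmDatum L 1 (Matrix.of fun i j : Fin 1 => if i.val + j.val + 1 = 1 then (1 : L) else 0)).Local v)) (Subgroup.centralizer ({x} : Set ((UnitaryGroup.cmDatum L 2 (Matrix.of fun i j : Fin 2 => if i.val + j.val + 1 = 2 then (1 : L) else 0)).Local v × (UnitaryGroup.cmDatum L 1 (Matrix.of fun i j : Fin 1 => if i.val + j.val + 1 = 1 then (1 : L) else 0)).Local v)))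
          ((Subgroup.centralizer ({x.1} : Set ((UnitaryGroup.cmDatum L 2 (Matrix.of fun i j : Fin 2 => if i.val + j.val + 1 = 2 then (1 : L) else 0)).Local v))).prod (Subgroup.centralizer ({x.2} : Set ((UnitaryGroup.cmDatum L 1 (Matrix.of fun i j : Fin 1 => if i.val + j.val + 1 = 1 then (1 : L) else 0)).Local v)))) hHH' continuous_id continuous_id := rfl
      rw [hκh]
      exact (Homeomorph.isCompact_preimage _).2 h1
    exact hKc.measure_lt_top
  · -- non-zero
    intro h0
    exact hμ ((Measure.map_eq_zero_iff hπm.aemeasurable).1 h0)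

/-! ## §3 The transport of the scaling law -/

/-- **(SC) ON `U(Φ₂)_v` ⇒ (SC) ON `H_v`.**  Let `z ∈ Z(H_v)`, `Ψ : U₂ → U₂`, `U₀ ⊆ U₂`, `q`, `a`.  If for every finite set `S₂` of classes of `U₂` over `z.1`
(`((out u · z.1⁻¹) − 1)² = 0`) and every `U₂`-family `mU₂` admissible on `S₂` the scaling law `Φ_{mU₂}(u, 1_{U₀}·(G∘Ψ)) = q^{a u}·Φ_{mU₂}(u, G)` holds for `G ∈ C_c^∞(U₂)`, then
for every finite set `S` of classes of `H_v` over `z`, every `H_v`-family `mU` admissible on `S`, every `u ∈ S` and `F ∈ C_c^∞(H_v)`: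
`Φ_{mU}(u, 1_{U₀ × U₁}·(F ∘ (Ψ × id))) = q^{a(⟦(out u).1⟧)}·Φ_{mU}(u, F)`.  Steps (1)–(4) of the module docstring. [cite: Gelbart1975, p. 155 (10.19)]
[cite: Rogawski1990, §4.9 p. 54; §8.1 Prop. 8.1.2 (b) p. 114] [cite: Folland1995, Thm. 2.49] -/
theorem classOrbitalIntegral_indicator_comp_prod_eq_mul (hns : Subsingleton (UnitaryGroup.PlacesOver L v))
    [MeasurableSpace ((UnitaryGroup.cmDatum L 2 (Matrix.of fun i j : Fin 2 => if i.val + j.val + 1 = 2 then (1 : L) else 0)).Local v × (UnitaryGroup.cmDatum L 1 (Matrix.of fun i j : Fin 1 => if i.val + j.val + 1 = 1 then (1 : L) else 0)).Local v)] [BorelSpace ((UnitaryGroup.cmDatum L 2 (Matrix.of fun i j : Fin 2 => if i.val + j.val + 1 = 2 then (1 : L) else 0)).Local v × (UnitaryGroup.cmDatum L 1 (Matrix.of fun i j : Fin 1 => if i.val + j.val + 1 = 1 then (1 : L) else 0)).Local v)]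
    [∀ a : (UnitaryGroup.cmDatum L 2 (Matrix.of fun i j : Fin 2 => if i.val + j.val + 1 = 2 then (1 : L) else 0)).Local v × (UnitaryGroup.cmDatum L 1 (Matrix.of fun i j : Fin 1 => if i.val + j.val + 1 = 1 then (1 : L) else 0)).Local v, MeasurableSpace (((UnitaryGroup.cmDatum L 2 (Matrix.of fun i j : Fin 2 => if i.val + j.val + 1 = 2 then (1 : L) else 0)).Local v × (UnitaryGroup.cmDatum L 1 (Matrix.of fun i j : Fin 1 => if i.val + j.val + 1 = 1 then (1 : L) else 0)).Local v) ⧸ Subgroup.centralizer ({a} : Set ((UnitaryGroup.cmDatum L 2 (Matrix.of fun i j : Fin 2 => if i.val + j.val + 1 = 2 then (1 : L) else 0)).Local v × (UnitaryGroup.cmDatum L 1 (Matrix.of fun i j : Fin 1 => if i.val + j.val + 1 = 1 then (1 : L) else 0)).Local v)))]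
    [∀ a : (UnitaryGroup.cmDatum L 2 (Matrix.of fun i j : Fin 2 => if i.val + j.val + 1 = 2 then (1 : L) else 0)).Local v × (UnitaryGroup.cmDatum L 1 (Matrix.of fun i j : Fin 1 => if i.val + j.val + 1 = 1 then (1 : L) else 0)).Local v, BorelSpace (((UnitaryGroup.cmDatum L 2 (Matrix.of fun i j : Fin 2 => if i.val + j.val + 1 = 2 then (1 : L) else 0)).Local v × (UnitaryGroup.cmDatum L 1 (Matrix.of fun i j : Fin 1 => if i.val + j.val + 1 = 1 then (1 : L) else 0)).Local v) ⧸ Subgroup.centralizer ({a} : Set ((UnitaryGroup.cmDatum L 2 (Matrix.of fun i j : Fin 2 => if i.val + j.val + 1 = 2 then (1 : L) else 0)).Local v × (UnitaryGroup.cmDatum L 1 (Matrix.of fun i j : Fin 1 => if i.val + j.val + 1 = 1 then (1 : L) else 0)).Local v)))]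
    [MeasurableSpace ((UnitaryGroup.cmDatum L 2 (Matrix.of fun i j : Fin 2 => if i.val + j.val + 1 = 2 then (1 : L) else 0)).Local v)] [BorelSpace ((UnitaryGroup.cmDatum L 2 (Matrix.of fun i j : Fin 2 => if i.val + j.val + 1 = 2 then (1 : L) else 0)).Local v)]
    [∀ γ : (UnitaryGroup.cmDatum L 2 (Matrix.of fun i j : Fin 2 => if i.val + j.val + 1 = 2 then (1 : L) else 0)).Local v, MeasurableSpace ((UnitaryGroup.cmDatum L 2 (Matrix.of fun i j : Fin 2 => if i.val + j.val + 1 = 2 then (1 : L) else 0)).Local v ⧸ Subgroup.centralizer ({γ} : Set ((UnitaryGroup.cmDatum L 2 (Matrix.of fun i j : Fin 2 => if i.val + j.val + 1 = 2 then (1 : L) else 0)).Local v)))]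
    [∀ γ : (UnitaryGroup.cmDatum L 2 (Matrix.of fun i j : Fin 2 => if i.val + j.val + 1 = 2 then (1 : L) else 0)).Local v, BorelSpace ((UnitaryGroup.cmDatum L 2 (Matrix.of fun i j : Fin 2 => if i.val + j.val + 1 = 2 then (1 : L) else 0)).Local v ⧸ Subgroup.centralizer ({γ} : Set ((UnitaryGroup.cmDatum L 2 (Matrix.of fun i j : Fin 2 => if i.val + j.val + 1 = 2 then (1 : L) else 0)).Local v)))]
    {Ψ : (UnitaryGroup.cmDatum L 2 (Matrix.of fun i j : Fin 2 => if i.val + j.val + 1 = 2 then (1 : L) else 0)).Local v → (UnitaryGroup.cmDatum L 2 (Matrix.of fun i j : Fin 2 => if i.val + j.val + 1 = 2 then (1 : L) else 0)).Local v} {U₀ : Set ((UnitaryGroup.cmDatum L 2 (Matrix.of fun i j : Fin 2 => if i.val + j.val + 1 = 2 then (1 : L) else 0)).Local v)} {q : ℂ} {a : ConjClasses ((UnitaryGroup.cmDatum L 2 (Matrix.of fun i j : Fin 2 => if i.val + j.val + 1 = 2 then (1 : L) else 0)).Local v) → ℕ}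
    {z : (UnitaryGroup.cmDatum L 2 (Matrix.of fun i j : Fin 2 => if i.val + j.val + 1 = 2 then (1 : L) else 0)).Local v × (UnitaryGroup.cmDatum L 1 (Matrix.of fun i j : Fin 1 => if i.val + j.val + 1 = 1 then (1 : L) else 0)).Local v} (hz : z ∈ Subgroup.center ((UnitaryGroup.cmDatum L 2 (Matrix.of fun i j : Fin 2 => if i.val + j.val + 1 = 2 then (1 : L) else 0)).Local v × (UnitaryGroup.cmDatum L 1 (Matrix.of fun i j : Fin 1 => if i.val + j.val + 1 = 1 then (1 : L) else 0)).Local v))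
    (hSC : ∀ (S₂ : Finset (ConjClasses ((UnitaryGroup.cmDatum L 2 (Matrix.of fun i j : Fin 2 => if i.val + j.val + 1 = 2 then (1 : L) else 0)).Local v))) (mU₂ : OrbitalMeasureFamily ((UnitaryGroup.cmDatum L 2 (Matrix.of fun i j : Fin 2 => if i.val + j.val + 1 = 2 then (1 : L) else 0)).Local v)),
      (∀ u ∈ S₂, (((Quotient.out u * z.1⁻¹ : (UnitaryGroup.cmDatum L 2 (Matrix.of fun i j : Fin 2 => if i.val + j.val + 1 = 2 then (1 : L) else 0)).Local v).val : GL (Fin 2) (UnitaryGroup.LocalRing L v)).val - 1) ^ 2 = 0) →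
      mU₂.IsAdmissibleOn (fun γ : (UnitaryGroup.cmDatum L 2 (Matrix.of fun i j : Fin 2 => if i.val + j.val + 1 = 2 then (1 : L) else 0)).Local v => ConjClasses.mk γ ∈ S₂) →
      ∀ u ∈ S₂, ∀ G : (UnitaryGroup.cmDatum L 2 (Matrix.of fun i j : Fin 2 => if i.val + j.val + 1 = 2 then (1 : L) else 0)).Local v → ℂ, IsLocSmooth G →
        classOrbitalIntegral mU₂ (U₀.indicator (G ∘ Ψ)) u = q ^ (a u) * classOrbitalIntegral mU₂ G u)
    (S : Finset (ConjClasses ((UnitaryGroup.cmDatum L 2 (Matrix.of fun i j : Fin 2 => if i.val + j.val + 1 = 2 then (1 : L) else 0)).Local v × (UnitaryGroup.cmDatum L 1 (Matrix.of fun i j : Fin 1 => if i.val + j.val + 1 = 1 then (1 : L) else 0)).Local v))) (mU : OrbitalMeasureFamily ((UnitaryGroup.cmDatum L 2 (Matrix.of fun i j : Fin 2 => if i.val + j.val + 1 = 2 then (1 : L) else 0)).Local v × (UnitaryGroup.cmDatum L 1 (Matrix.of fun i j : Fin 1 => if i.val + j.val + 1 = 1 then (1 : L) else 0)).Local v))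
    (hunip : ∀ u ∈ S, ((((Quotient.out u * z⁻¹).1).val : GL (Fin 2) (UnitaryGroup.LocalRing L v)).val - 1) ^ 2 = 0 ∧ (Quotient.out u * z⁻¹).2 = 1)
    (hadm : mU.IsAdmissibleOn (fun γ : (UnitaryGroup.cmDatum L 2 (Matrix.of fun i j : Fin 2 => if i.val + j.val + 1 = 2 then (1 : L) else 0)).Local v × (UnitaryGroup.cmDatum L 1 (Matrix.of fun i j : Fin 1 => if i.val + j.val + 1 = 1 then (1 : L) else 0)).Local v => ConjClasses.mk γ ∈ S))
    {u : ConjClasses ((UnitaryGroup.cmDatum L 2 (Matrix.of fun i j : Fin 2 => if i.val + j.val + 1 = 2 then (1 : L) else 0)).Local v × (UnitaryGroup.cmDatum L 1 (Matrix.of fun i j : Fin 1 => if i.val + j.val + 1 = 1 then (1 : L) else 0)).Local v)} (hu : u ∈ S) (F : (UnitaryGroup.cmDatum L 2 (Matrix.of fun i j : Fin 2 => if i.val + j.val + 1 = 2 then (1 : L) else 0)).Local v × (UnitaryGroup.cmDatum L 1 (Matrix.of fun i j : Fin 1 => if i.val + j.val + 1 = 1 then (1 : L) else 0)).Local v → ℂ)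 (hF : IsLocSmooth F) :
    classOrbitalIntegral mU ((U₀ ×ˢ (Set.univ : Set ((UnitaryGroup.cmDatum L 1 (Matrix.of fun i j : Fin 1 => if i.val + j.val + 1 = 1 then (1 : L) else 0)).Local v))).indicator (F ∘ fun γ : (UnitaryGroup.cmDatum L 2 (Matrix.of fun i j : Fin 2 => if i.val + j.val + 1 = 2 then (1 : L) else 0)).Local v × (UnitaryGroup.cmDatum L 1 (Matrix.of fun i j : Fin 1 => if i.val + j.val + 1 = 1 then (1 : L) else 0)).Local v => (Ψ γ.1, γ.2))) u =
      q ^ (a (ConjClasses.mk (Quotient.out u).1)) * classOrbitalIntegral mU F u := by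
  classical
  -- the representative `x = out u` and its member `μ = mU u`
  set x : (UnitaryGroup.cmDatum L 2 (Matrix.of fun i j : Fin 2 => if i.val + j.val + 1 = 2 then (1 : L) else 0)).Local v × (UnitaryGroup.cmDatum L 1 (Matrix.of fun i j : Fin 1 => if i.val + j.val + 1 = 1 then (1 : L) else 0)).Local v := Quotient.out u with hxdef
  have hmk : ConjClasses.mk x = u := Quotient.out_eq u
  have hPu : ConjClasses.mk (Quotient.out u) ∈ S := by
    rw [show ConjClasses.mk (Quotient.out u) = u from Quotient.out_eq u]
    exact hu
  obtain ⟨hne, hinv, hfin⟩ := hadm u hPu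
  haveI := hinv
  haveI := hfin
  -- (1) a non-zero invariant Radon measure on `U₂ ⧸ Z(x₁)`
  obtain ⟨μ₁, hμ₁i, hμ₁f, hμ₁s, hμ₁0⟩ := exists_smulInvariantMeasure_quotient_fst L v hns x (mU u) hne
  haveI := hμ₁i
  haveI := hμ₁f
  haveI := hμ₁s
  haveI : IsClosed ((Subgroup.centralizer ({x.1} : Set ((UnitaryGroup.cmDatum L 2 (Matrix.of fun i j : Fin 2 => if i.val + j.val + 1 = 2 then (1 : L) else 0)).Local v)) : Subgroup ((UnitaryGroup.cmDatum L 2 (Matrix.of fun i j : Fin 2 => if i.val + j.val + 1 = 2 then (1 : L) else 0)).Local v)) : Set ((UnitaryGroup.cmDatum L 2 (Matrix.of fun i j : Fin 2 => if i.val + j.val + 1 = 2 then (1 : L) else 0)).Local v)) := isClosed_coe_centralizer_singleton x.1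
  -- (2) Gelbart (10.19) for ANY invariant measure: `U₁` commutative
  letI : CommGroup ((UnitaryGroup.cmDatum L 1 (Matrix.of fun i j : Fin 1 => if i.val + j.val + 1 = 1 then (1 : L) else 0)).Local v) := { (inferInstance : Group ((UnitaryGroup.cmDatum L 1 (Matrix.of fun i j : Fin 1 => if i.val + j.val + 1 = 1 then (1 : L) else 0)).Local v)) with mul_comm := cmDatum_local_one_mul_comm L v }
  have hx : (MulEquiv.refl ((UnitaryGroup.cmDatum L 2 (Matrix.of fun i j : Fin 2 => if i.val + j.val + 1 = 2 then (1 : L) else 0)).Local v × (UnitaryGroup.cmDatum L 1 (Matrix.of fun i j : Fin 1 => if i.val + j.val + 1 = 1 then (1 : L) else 0)).Local v)) (x.1, x.2) = x := rfl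
  obtain ⟨c, hc0, hc⟩ := exists_integral_descConj_eq_smul_of_comm (MulEquiv.refl ((UnitaryGroup.cmDatum L 2 (Matrix.of fun i j : Fin 2 => if i.val + j.val + 1 = 2 then (1 : L) else 0)).Local v × (UnitaryGroup.cmDatum L 1 (Matrix.of fun i j : Fin 1 => if i.val + j.val + 1 = 1 then (1 : L) else 0)).Local v)) continuous_id continuous_id hx
    (isClosed_coe_centralizer_singleton x.1) (mU u) μ₁ hne hμ₁0
  -- (3) the one-class `U₂`-family at `⟦x₁⟧`: transport `μ₁` along `y x₁ y⁻¹ = out ⟦x₁⟧`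
  obtain ⟨y, hy⟩ := isConj_iff.1 (ConjClasses.mk_eq_mk_iff_isConj.1 (Quotient.out_eq (ConjClasses.mk x.1)).symm)
  -- `hy : y * x.1 * y⁻¹ = Quotient.out (ConjClasses.mk x.1)`
  have hee : ∀ g : (UnitaryGroup.cmDatum L 2 (Matrix.of fun i j : Fin 2 => if i.val + j.val + 1 = 2 then (1 : L) else 0)).Local v, (MulAut.conj y) g ∈ Subgroup.centralizer ({Quotient.out (ConjClasses.mk x.1)} : Set ((UnitaryGroup.cmDatum L 2 (Matrix.of fun i j : Fin 2 => if i.val + j.val + 1 = 2 then (1 : L) else 0)).Local v)) ↔ g ∈ Subgroup.centralizer ({x.1} : Set ((UnitaryGroup.cmDatum L 2 (Matrix.of fun i j : Fin 2 => if i.val + j.val + 1 = 2 then (1 : L) else 0)).Local v)) := by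
    intro g
    rw [← hy]
    exact mulEquiv_apply_mem_centralizer_singleton_iff (MulAut.conj y) x.1 g
  have hconjc : Continuous (MulAut.conj y : (UnitaryGroup.cmDatum L 2 (Matrix.of fun i j : Fin 2 => if i.val + j.val + 1 = 2 then (1 : L) else 0)).Local v ≃* (UnitaryGroup.cmDatum L 2 (Matrix.of fun i j : Fin 2 => if i.val + j.val + 1 = 2 then (1 : L) else 0)).Local v) := (continuous_const.mul continuous_id).mul continuous_const
  have hconjs : Continuous (MulAut.conj y : (UnitaryGroup.cmDatum L 2 (Matrix.of fun i j : Fin 2 => if i.val + j.val + 1 = 2 then (1 : L) else 0)).Local v ≃* (UnitaryGroup.cmDatum L 2 (Matrix.of fun i j : Fin 2 => if i.val + j.val + 1 = 2 then (1 : L) else 0)).Local v).symm := (continuous_const.mul continuous_id).mul continuous_const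
  set ψ := cosetCongrHomeomorph (MulAut.conj y) (Subgroup.centralizer ({x.1} : Set ((UnitaryGroup.cmDatum L 2 (Matrix.of fun i j : Fin 2 => if i.val + j.val + 1 = 2 then (1 : L) else 0)).Local v))) (Subgroup.centralizer ({Quotient.out (ConjClasses.mk x.1)} : Set ((UnitaryGroup.cmDatum L 2 (Matrix.of fun i j : Fin 2 => if i.val + j.val + 1 = 2 then (1 : L) else 0)).Local v))) hee hconjc hconjs with hψdef
  set μ₂ : Measure ((UnitaryGroup.cmDatum L 2 (Matrix.of fun i j : Fin 2 => if i.val + j.val + 1 = 2 then (1 : L) else 0)).Local v ⧸ Subgroup.centralizer ({Quotient.out (ConjClasses.mk x.1)} : Set ((UnitaryGroup.cmDatum L 2 (Matrix.of fun i j : Fin 2 => if i.val + j.val + 1 = 2 then (1 : L) else 0)).Local v))) := Measure.map ψ μ₁ with hμ₂def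
  haveI hμ₂i : SMulInvariantMeasure ((UnitaryGroup.cmDatum L 2 (Matrix.of fun i j : Fin 2 => if i.val + j.val + 1 = 2 then (1 : L) else 0)).Local v) _ μ₂ := by
    rw [hμ₂def, show (ψ : _ → _) = cosetCongr (MulAut.conj y) _ _ hee from rfl]
    exact smulInvariantMeasure_map_cosetCongr_of_smulInvariant (MulAut.conj y) hconjc _ _ hee μ₁
  haveI hμ₂f : IsFiniteMeasureOnCompacts μ₂ := IsFiniteMeasureOnCompacts.map μ₁ ψ
  have hμ₂0 : μ₂ ≠ 0 := by
    rw [hμ₂def, Ne, Measure.map_eq_zero_iff ψ.measurable.aemeasurable]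
    exact hμ₁0
  set mU₂ : OrbitalMeasureFamily ((UnitaryGroup.cmDatum L 2 (Matrix.of fun i j : Fin 2 => if i.val + j.val + 1 = 2 then (1 : L) else 0)).Local v) := fun c' => if h : c' = ConjClasses.mk x.1 then h ▸ μ₂ else 0 with hmU₂def
  have hmU₂x : mU₂ (ConjClasses.mk x.1) = μ₂ := by simp only [hmU₂def, dif_pos rfl]
  -- `⟦x₁⟧` lies over `z.1`: the `H`-literal for `(y, 1)·x·(y, 1)⁻¹`
  have hlitH := (centralUnipotent_conj_iff hz x ((y, (1 : (UnitaryGroup.cmDatum L 1 (Matrix.of fun i j : Fin 1 => if i.val + j.val + 1 = 1 then (1 : L) else 0)).Local v)) : (UnitaryGroup.cmDatum L 2 (Matrix.of fun i j : Fin 2 => if i.val + j.val + 1 = 2 then (1 : L) else 0)).Local v × (UnitaryGroup.cmDatum L 1 (Matrix.of fun i j : Fin 1 => if i.val + j.val + 1 = 1 then (1 : L) else 0)).Local v)).2 (hunip u hu)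
  have hlit2 : (((Quotient.out (ConjClasses.mk x.1) * z.1⁻¹ : (UnitaryGroup.cmDatum L 2 (Matrix.of fun i j : Fin 2 => if i.val + j.val + 1 = 2 then (1 : L) else 0)).Local v).val : GL (Fin 2) (UnitaryGroup.LocalRing L v)).val - 1) ^ 2 = 0 := by
    rw [← hy]
    exact hlitH.1
  have hunip₂ : ∀ u' ∈ ({ConjClasses.mk x.1} : Finset (ConjClasses ((UnitaryGroup.cmDatum L 2 (Matrix.of fun i j : Fin 2 => if i.val + j.val + 1 = 2 then (1 : L) else 0)).Local v))),
      (((Quotient.out u' * z.1⁻¹ : (UnitaryGroup.cmDatum L 2 (Matrix.of fun i j : Fin 2 => if i.val + j.val + 1 = 2 then (1 : L) else 0)).Local v).val : GL (Fin 2) (UnitaryGroup.LocalRing L v)).val - 1) ^ 2 = 0 := by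
    intro u' hu'
    rw [Finset.mem_singleton] at hu'
    subst hu'
    exact hlit2
  have hadm₂ : mU₂.IsAdmissibleOn (fun γ : (UnitaryGroup.cmDatum L 2 (Matrix.of fun i j : Fin 2 => if i.val + j.val + 1 = 2 then (1 : L) else 0)).Local v => ConjClasses.mk γ ∈ ({ConjClasses.mk x.1} : Finset (ConjClasses ((UnitaryGroup.cmDatum L 2 (Matrix.of fun i j : Fin 2 => if i.val + j.val + 1 = 2 then (1 : L) else 0)).Local v)))) := by
    intro c' hc'
    have hmk2 : ∀ c : ConjClasses ((UnitaryGroup.cmDatum L 2 (Matrix.of fun i j : Fin 2 => if i.val + j.val + 1 = 2 then (1 : L) else 0)).Local v), ConjClasses.mk (Quotient.out c) = c := fun c => Quotient.out_eq c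
    have hc'' : c' = ConjClasses.mk x.1 := by
      have h := hc'
      simp only [hmk2, Finset.mem_singleton] at h
      exact h
    subst hc''
    rw [hmU₂x]
    exact ⟨hμ₂0, hμ₂i, hμ₂f⟩
  -- the constant `c′` relating `Φ_{mU₂}(⟦x₁⟧, ·)` to `∫_{U₂⧸Z(x₁)} · dμ₁`
  obtain ⟨c', hc'0, hc'⟩ := exists_integral_descConj_eq_smul_integral_descConj_of_conj_eq y hy μ₁ μ₂ hμ₁0 hμ₂0
  have hclass : ∀ K : (UnitaryGroup.cmDatum L 2 (Matrix.of fun i j : Fin 2 => if i.val + j.val + 1 = 2 then (1 : L) else 0)).Local v → ℂ, classOrbitalIntegral mU₂ K (ConjClasses.mk x.1) =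
      c' • ∫ t, descConj x.1 (Subgroup.centralizer ({x.1} : Set ((UnitaryGroup.cmDatum L 2 (Matrix.of fun i j : Fin 2 => if i.val + j.val + 1 = 2 then (1 : L) else 0)).Local v))) (centralizer_comm x.1) K t ∂μ₁ := by
    intro K
    rw [classOrbitalIntegral_eq, hmU₂x, orbitalIntegral_eq_integral_descConj]
    exact hc' K
  -- (4) the two sections and the `U₂`-law at `⟦x₁⟧`
  have hsec := isLocSmooth_section L v hF x.2
  have hSC₁ := hSC {ConjClasses.mk x.1} mU₂ hunip₂ hadm₂ (ConjClasses.mk x.1) (Finset.mem_singleton_self _) (fun g => F (g, x.2)) hsec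
  rw [hclass, hclass] at hSC₁
  -- the `H_v`-side integrals through (10.19)
  have hH₁ : classOrbitalIntegral mU ((U₀ ×ˢ (Set.univ : Set ((UnitaryGroup.cmDatum L 1 (Matrix.of fun i j : Fin 1 => if i.val + j.val + 1 = 1 then (1 : L) else 0)).Local v))).indicator (F ∘ fun γ : (UnitaryGroup.cmDatum L 2 (Matrix.of fun i j : Fin 2 => if i.val + j.val + 1 = 2 then (1 : L) else 0)).Local v × (UnitaryGroup.cmDatum L 1 (Matrix.of fun i j : Fin 1 => if i.val + j.val + 1 = 1 then (1 : L) else 0)).Local v => (Ψ γ.1, γ.2))) u =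
      c • ∫ t, descConj x.1 (Subgroup.centralizer ({x.1} : Set ((UnitaryGroup.cmDatum L 2 (Matrix.of fun i j : Fin 2 => if i.val + j.val + 1 = 2 then (1 : L) else 0)).Local v))) (centralizer_comm x.1) (U₀.indicator ((fun g : (UnitaryGroup.cmDatum L 2 (Matrix.of fun i j : Fin 2 => if i.val + j.val + 1 = 2 then (1 : L) else 0)).Local v => F (g, x.2)) ∘ Ψ)) t ∂μ₁ := by
    rw [classOrbitalIntegral_eq, orbitalIntegral_eq_integral_descConj, hc]
    have hfun : (fun g : (UnitaryGroup.cmDatum L 2 (Matrix.of fun i j : Fin 2 => if i.val + j.val + 1 = 2 then (1 : L) else 0)).Local v => ((U₀ ×ˢ (Set.univ : Set ((UnitaryGroup.cmDatum L 1 (Matrix.of fun i j : Fin 1 => if i.val + j.val + 1 = 1 then (1 : L) else 0)).Local v))).indicator (F ∘ fun γ : (UnitaryGroup.cmDatum L 2 (Matrix.of fun i j : Fin 2 => if i.val + j.val + 1 = 2 then (1 : L) else 0)).Local v × (UnitaryGroup.cmDatum L 1 (Matrix.of fun i j : Fin 1 => if i.val + j.val + 1 = 1 then (1 : L) else 0)).Local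 v => (Ψ γ.1, γ.2)))
        ((MulEquiv.refl ((UnitaryGroup.cmDatum L 2 (Matrix.of fun i j : Fin 2 => if i.val + j.val + 1 = 2 then (1 : L) else 0)).Local v × (UnitaryGroup.cmDatum L 1 (Matrix.of fun i j : Fin 1 => if i.val + j.val + 1 = 1 then (1 : L) else 0)).Local v)) (g, x.2))) = U₀.indicator ((fun g : (UnitaryGroup.cmDatum L 2 (Matrix.of fun i j : Fin 2 => if i.val + j.val + 1 = 2 then (1 : L) else 0)).Local v => F (g, x.2)) ∘ Ψ) :=
      funext fun g => indicator_prod_univ_comp_apply L v U₀ Ψ F g x.2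
    rw [hfun]
  have hH₂ : classOrbitalIntegral mU F u = c • ∫ t, descConj x.1 (Subgroup.centralizer ({x.1} : Set ((UnitaryGroup.cmDatum L 2 (Matrix.of fun i j : Fin 2 => if i.val + j.val + 1 = 2 then (1 : L) else 0)).Local v))) (centralizer_comm x.1) (fun g : (UnitaryGroup.cmDatum L 2 (Matrix.of fun i j : Fin 2 => if i.val + j.val + 1 = 2 then (1 : L) else 0)).Local v => F (g, x.2)) t ∂μ₁ := by
    rw [classOrbitalIntegral_eq, orbitalIntegral_eq_integral_descConj, hc]
    rfl
  -- cancel `c′` in the `U₂`-law and rescale by `c`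
  have hc'C : ((c' : ℝ) : ℂ) ≠ 0 := by exact_mod_cast hc'0
  have hlaw : ∫ t, descConj x.1 (Subgroup.centralizer ({x.1} : Set ((UnitaryGroup.cmDatum L 2 (Matrix.of fun i j : Fin 2 => if i.val + j.val + 1 = 2 then (1 : L) else 0)).Local v))) (centralizer_comm x.1) (U₀.indicator ((fun g : (UnitaryGroup.cmDatum L 2 (Matrix.of fun i j : Fin 2 => if i.val + j.val + 1 = 2 then (1 : L) else 0)).Local v => F (g, x.2)) ∘ Ψ)) t ∂μ₁ =
      q ^ (a (ConjClasses.mk x.1)) * ∫ t, descConj x.1 (Subgroup.centralizer ({x.1} : Set ((UnitaryGroup.cmDatum L 2 (Matrix.of fun i j : Fin 2 => if i.val + j.val + 1 = 2 then (1 : L) else 0)).Local v))) (centralizer_comm x.1) (fun g : (UnitaryGroup.cmDatum L 2 (Matrix.of fun i j : Fin 2 => if i.val + j.val + 1 = 2 then (1 : L) else 0)).Local v => F (g, x.2)) t ∂μ₁ := by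
    rw [NNReal.smul_def, NNReal.smul_def, Complex.real_smul, Complex.real_smul] at hSC₁
    refine mul_left_cancel₀ hc'C ?_
    rw [hSC₁]
    ring
  rw [hH₁, hH₂, hlaw, NNReal.smul_def, NNReal.smul_def, Complex.real_smul, Complex.real_smul]
  ring

end Summit.HodgeConjecture.HodgeConjecture.Cruxes.H413.K2E3CentralUnipotentScalingOfFactor

end
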